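import Mathlib

set_option linter.dupNamespace false

/-!
# `SnSubsetDichotomy.HyperoctahedralSubsets` — stub `stub_disjointWalks`

Registered stub `stub_disjointWalks` of line `spherical-rank-sieve` (crux
`stmt-MatrixMultiplication-8305`).  Pure finite combinatorics.

Data: permutations `μ 0, μ 1, μ 2` of `Fin n`, a cyclic colour word `col : Fin (k + 2) → Fin 3`, a
finset `S` of closed walks of `col` (`p : Fin (k + 2) → Fin n` with `μ (col i) (p i) = p (i + 1)`
for all `i`, indices mod `k + 2`) and a forbidden finset `R` of points.  Claim: there is `S' ⊆ S`,
pairwise point-disjoint, every walk of `S'` avoiding `R`, with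
`|S| ≤ |S'| ((k + 2) (k + 2) + 1) + (k + 2) |R|`.

Proof.  *Forward determination* (`DisjointWalks.eq_of_apply_eq`): two closed walks of `col`
agreeing at one position agree everywhere (iterate the step equation around the cycle).  Hence
for a fixed position `i` and point `r` at most one walk of `S` has `p i = r`
(`DisjointWalks.card_filter_apply_eq_le_one`).  Consequently at most `(k + 2) |R|` walks of `S`
meet `R` (`DisjointWalks.card_le_card_filter_add`), and in the conflict graph "share a point" on
the `R`-avoiding walks every walk has at most `(k + 2) (k + 2)` neighbours (itself included,
`DisjointWalks.card_filter_exists_le`), so the greedy independent set `S'` has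
`|R-avoiding walks| ≤ |S'| ((k + 2) (k + 2) + 1)` (`DisjointWalks.greedy`, strong induction on the
finset).
-/

namespace Summit.MatrixMultiplication.MatrixMultiplication.Theorems.HyperoctahedralSubsets

namespace DisjointWalks

variable {n k : ℕ}

open Fin.NatCast in
/-- Forward determination: two closed walks of the same colour word which agree at one position
are equal. [folklore] -/
theorem eq_of_apply_eq (μ : Fin 3 → Equiv.Perm (Fin n)) (col : Fin (k + 2) → Fin 3)
    {p q : Fin (k + 2) → Fin n} (hp : ∀ i, μ (col i) (p i) = p (i + 1))
    (hq : ∀ i, μ (col i) (q i) = q (i + 1)) {i : Fin (k + 2)} (h : p i = q i) : p = q := by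
  have key : ∀ t : ℕ, p (i + (t : Fin (k + 2))) = q (i + (t : Fin (k + 2))) := by
    intro t
    induction t with
    | zero => simpa using h
    | succ t ih =>
      have e : i + ((t + 1 : ℕ) : Fin (k + 2)) = i + (t : Fin (k + 2)) + 1 := by
        rw [Nat.cast_succ, add_assoc]
      rw [e, ← hp (i + t), ← hq (i + t), ih]
  funext j
  have hj : i + (((j - i : Fin (k + 2)) : ℕ) : Fin (k + 2)) = j := by
    rw [Fin.cast_val_eq_self]
    abel
  rw [← hj]
  exact key _

/-- For a fixed position `i` and point `r`, at most one closed walk of a finset of closed walks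
takes the value `r` at `i`. [folklore] -/
theorem card_filter_apply_eq_le_one (μ : Fin 3 → Equiv.Perm (Fin n)) (col : Fin (k + 2) → Fin 3)
    (S : Finset (Fin (k + 2) → Fin n)) (hS : ∀ p ∈ S, ∀ i, μ (col i) (p i) = p (i + 1))
    (i : Fin (k + 2)) (r : Fin n) : (S.filter (fun p => p i = r)).card ≤ 1 := by
  refine Finset.card_le_one.2 fun p hp q hq => ?_
  rw [Finset.mem_filter] at hp hq
  exact eq_of_apply_eq μ col (hS p hp.1) (hS q hq.1) (hp.2.trans hq.2.symm)

/-- At most `(k + 2) |R|` closed walks of `S` meet `R`: the number of walks of `S` is at most the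
number of `R`-avoiding ones plus `(k + 2) |R|`. [folklore] -/
theorem card_le_card_filter_add (μ : Fin 3 → Equiv.Perm (Fin n)) (col : Fin (k + 2) → Fin 3)
    (S : Finset (Fin (k + 2) → Fin n)) (R : Finset (Fin n))
    (hS : ∀ p ∈ S, ∀ i, μ (col i) (p i) = p (i + 1)) :
    S.card ≤ (S.filter (fun p => ∀ i, p i ∉ R)).card + (k + 2) * R.card := by
  have h1 := Finset.card_filter_add_card_filter_not (s := S)
    (fun p : Fin (k + 2) → Fin n => ∀ i, p i ∉ R)
  have h2 : (S.filter (fun p : Fin (k + 2) → Fin n => ¬ ∀ i, p i ∉ R)).card ≤ (k + 2) * R.card :=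
    calc (S.filter (fun p : Fin (k + 2) → Fin n => ¬ ∀ i, p i ∉ R)).card
        ≤ ((Finset.univ : Finset (Fin (k + 2))).biUnion
            (fun i => R.biUnion (fun r => S.filter (fun p => p i = r)))).card := by
          refine Finset.card_le_card fun p hp => ?_
          simp only [Finset.mem_filter, not_forall, not_not] at hp
          obtain ⟨hpS, i, hi⟩ := hp
          simp only [Finset.mem_biUnion, Finset.mem_univ, true_and, Finset.mem_filter]
          exact ⟨i, p i, hi, hpS, rfl⟩
      _ ≤ (Finset.univ : Finset (Fin (k + 2))).card * (R.card * 1) :=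
          Finset.card_biUnion_le_card_mul _ _ _ fun i _ =>
            Finset.card_biUnion_le_card_mul _ _ _ fun r _ =>
              card_filter_apply_eq_le_one μ col S hS i r
      _ = (k + 2) * R.card := by rw [Finset.card_univ, Fintype.card_fin, mul_one]
  omega

/-- In a finset `T` of closed walks, the walks sharing a point with a given walk `p` (in any pair
of positions) number at most `(k + 2) (k + 2)`. [folklore] -/
theorem card_filter_exists_le (μ : Fin 3 → Equiv.Perm (Fin n)) (col : Fin (k + 2) → Fin 3)
    (T : Finset (Fin (k + 2) → Fin n)) (hT : ∀ q ∈ T, ∀ i, μ (col i) (q i) = q (i + 1))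
    (p : Fin (k + 2) → Fin n) :
    (T.filter (fun q => ∃ i j, q j = p i)).card ≤ (k + 2) * (k + 2) :=
  calc (T.filter (fun q => ∃ i j, q j = p i)).card
      ≤ ((Finset.univ : Finset (Fin (k + 2) × Fin (k + 2))).biUnion
          (fun ij => T.filter (fun q => q ij.2 = p ij.1))).card := by
        refine Finset.card_le_card fun q hq => ?_
        simp only [Finset.mem_filter] at hq
        obtain ⟨hqT, i, j, hij⟩ := hq
        simp only [Finset.mem_biUnion, Finset.mem_univ, true_and, Finset.mem_filter, Prod.exists]
        exact ⟨i, j, hqT, hij⟩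
    _ ≤ (Finset.univ : Finset (Fin (k + 2) × Fin (k + 2))).card * 1 :=
        Finset.card_biUnion_le_card_mul _ _ _ fun ij _ =>
          card_filter_apply_eq_le_one μ col T hT ij.2 (p ij.1)
    _ = (k + 2) * (k + 2) := by
        rw [Finset.card_univ, Fintype.card_prod, Fintype.card_fin, mul_one]

/-- Greedy independent set in the conflict graph "share a point": a finset `T` of closed walks
contains a pairwise point-disjoint `T' ⊆ T` with `|T| ≤ |T'| ((k + 2) (k + 2) + 1)`. [folklore] -/
theorem greedy (μ : Fin 3 → Equiv.Perm (Fin n)) (col : Fin (k + 2) → Fin 3)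
    (T : Finset (Fin (k + 2) → Fin n)) (hT : ∀ q ∈ T, ∀ i, μ (col i) (q i) = q (i + 1)) :
    ∃ T' : Finset (Fin (k + 2) → Fin n), T' ⊆ T ∧
      T.card ≤ T'.card * ((k + 2) * (k + 2) + 1) ∧
      (∀ p ∈ T', ∀ q ∈ T', p ≠ q → ∀ i j, p i ≠ q j) := by
  induction T using Finset.strongInduction with
  | H T ih =>
    rcases T.eq_empty_or_nonempty with hTe | ⟨p, hp⟩
    · refine ⟨∅, Finset.empty_subset _, ?_, ?_⟩
      · simp [hTe]
      · simp
    · set N := T.filter (fun q => ∃ i j, q j = p i) with hN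
      have hpN : p ∈ N := Finset.mem_filter.2 ⟨hp, 0, 0, rfl⟩
      have hNT : N ⊆ T := Finset.filter_subset _ _
      obtain ⟨T'', hsub, hcard, hdisj⟩ := ih (T \ N) (Finset.sdiff_ssubset hNT ⟨p, hpN⟩)
        (fun q hq => hT q (Finset.sdiff_subset hq))
      have hpT'' : p ∉ T'' := fun h => (Finset.mem_sdiff.1 (hsub h)).2 hpN
      refine ⟨insert p T'', Finset.insert_subset hp (hsub.trans Finset.sdiff_subset), ?_, ?_⟩
      · have h1 := Finset.card_le_card_sdiff_add_card (s := T) (t := N)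
        have h2 : N.card ≤ (k + 2) * (k + 2) := card_filter_exists_le μ col T hT p
        rw [Finset.card_insert_of_notMem hpT'', add_one_mul]
        omega
      · intro a ha b hb hab i j h
        rw [Finset.mem_insert] at ha hb
        rcases ha with rfl | ha
        · rcases hb with rfl | hb
          · exact hab rfl
          · exact (Finset.mem_sdiff.1 (hsub hb)).2
              (Finset.mem_filter.2 ⟨(Finset.mem_sdiff.1 (hsub hb)).1, i, j, h.symm⟩)
        · rcases hb with rfl | hb
          · exact (Finset.mem_sdiff.1 (hsub ha)).2
              (Finset.mem_filter.2 ⟨(Finset.mem_sdiff.1 (hsub ha)).1, j, i, h⟩)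
          · exact hdisj a ha b hb hab i j h

end DisjointWalks

/-- **Stub `stub_disjointWalks`** (line `spherical-rank-sieve`).  From a finset `S` of injective
closed walks of one colour word extract `S' ⊆ S` of pairwise point-disjoint walks avoiding `R`
with `|S| ≤ |S'| ((k + 2) (k + 2) + 1) + (k + 2) |R|`: at most `(k + 2) |R|` walks of `S` meet `R`
(forward determination), and in the conflict graph "share a point" every walk has degree at most
`(k + 2) (k + 2)`, so a greedy independent set has the stated size. -/
theorem stub_disjointWalks : ∀ (n k : ℕ) (μ : Fin 3 → Equiv.Perm (Fin n)) (col : Fin (k + 2) → Fin 3) (S : Finset (Fin (k + 2) → Fin n)) (R : Finset (Fin n)), (∀ p ∈ S, (∀ i, μ (col i) (p i) = p (i + 1)) ∧ Function.Injective p) → ∃ S' : Finset (Fin (k + 2) → Fin n), S' ⊆ S ∧ S.card ≤ S'.card * ((k + 2) * (k + 2) + 1) + (k + 2) * R.card ∧ (∀ p ∈ S', ∀ q ∈ S', p ≠ q → ∀ i j, p i ≠ q j) ∧ (∀ p ∈ S', ∀ i, p i ∉ R) := by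
  intro n k μ col S R hS
  obtain ⟨S', hsub, hcard, hdisj⟩ :=
    DisjointWalks.greedy μ col (S.filter (fun p => ∀ i, p i ∉ R))
      (fun q hq => (hS q (Finset.mem_filter.1 hq).1).1)
  refine ⟨S', hsub.trans (Finset.filter_subset _ _), ?_, hdisj,
    fun p hp i => (Finset.mem_filter.1 (hsub hp)).2 i⟩
  have h := DisjointWalks.card_le_card_filter_add μ col S R (fun q hq => (hS q hq).1)
  omega

end Summit.MatrixMultiplication.MatrixMultiplication.Theorems.HyperoctahedralSubsets
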